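import Literature.ComputerArithmetic.LangeRump2018.Proposition1

/-!
# Lange–Rump 2019, Proposition 14 PROVED (and generalised): blocked summation `≤ (n + m - 2)·u`

HONEST FRAMING (venture CertifiedArithmetic / cell `pub-lowprec`): certified error envelopes and
provably optimal rounding/accumulation schemes for low-precision formats under stated cost models;
every table by two implementations; no hardware or vendor claims.

[LangeRump2018, Prop 14] (M. Lange, S. M. Rump, Math. Comp. 88 (2019), §6): blocked floating-point
summation of `x ∈ F^{mn}` with fixed block size `m` (`n` blocks), nearest rounding,
`max(m, n) ≤ 1 + ½u⁻¹` ⟹ `|s - Σ xᵢⱼ| ≤ (n + m - 2)·u·Σ|xᵢⱼ|`, via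
`p/(1+p)·(1 + q/(1+q)) + q/(1+q) ≤ p + q` with `p = (n-1)u`, `q = (m-1)u`. PROVED here over the
number system of `JeannerodRump2018/Summation.lean`, GENERALISED to arbitrary evaluation trees
inside the blocks and an arbitrary outer tree over the block results (the paper: recursive),
blocks of at most `K` leaves, `B` blocks: `proposition14` gives `((K-1) + (B-1))·u·Σ|x|` and
`abs_twoLevel_sub_exact_le` the sharper intermediate form
`[θ_{K-1} + θ_{B-1}(1 + θ_{K-1})]·Σ|x|`, `θ_k = k u/(1+k u)`, from Proposition 1 at both levels.
-/

namespace Literature.ComputerArithmetic.LangeRump2018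

open Literature.ComputerArithmetic.JeannerodRump2018
open Literature.ComputerArithmetic.JeannerodRump2018.SumTree

variable {p : ℕ} {emin : ℤ} {fl : ℚ → ℚ}

section Arith

variable {K : Type*} [Field K] [LinearOrder K] [IsStrictOrderedRing K]

/-- `x ↦ x u/(1 + x u)` is monotone on `x ≥ 0` (any ordered field). [cite: LangeRump2018, §6] -/
theorem const_mono {a b u : K} (ha : 0 ≤ a) (hab : a ≤ b) (hu : 0 ≤ u) :
    a * u / (1 + a * u) ≤ b * u / (1 + b * u) := by
  have hau : 0 ≤ a * u := mul_nonneg ha hu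
  have hbu : a * u ≤ b * u := mul_le_mul_of_nonneg_right hab hu
  rw [div_le_div_iff₀ (by linarith) (by linarith)]
  nlinarith

/-- The algebra of [LangeRump2018, Prop 14]: `q/(1+q) + p/(1+p)·(1 + q/(1+q)) ≤ p + q` for
`p, q ≥ 0` (any ordered field). [cite: LangeRump2018, Prop 14 (proof)] -/
theorem blocked_const_le {a b : K} (ha : 0 ≤ a) (hb : 0 ≤ b) :
    b / (1 + b) + a / (1 + a) * (1 + b / (1 + b)) ≤ a + b := by
  have ha1 : (0 : K) < 1 + a := by linarith
  have hb1 : (0 : K) < 1 + b := by linarith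
  have key : a + b - (b / (1 + b) + a / (1 + a) * (1 + b / (1 + b)))
      = (a ^ 2 + b ^ 2 - a * b + (a + b) * (a * b)) / ((1 + a) * (1 + b)) := by
    field_simp
    ring
  have hnum : 0 ≤ a ^ 2 + b ^ 2 - a * b + (a + b) * (a * b) := by
    nlinarith [sq_nonneg (a - b), mul_nonneg ha hb, mul_nonneg (add_nonneg ha hb) (mul_nonneg ha hb)]
  have : 0 ≤ (a ^ 2 + b ^ 2 - a * b + (a + b) * (a * b)) / ((1 + a) * (1 + b)) :=
    div_nonneg hnum (mul_pos ha1 hb1).le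
  linarith

end Arith

/-- The exact sum of a tree is the sum of its leaves. [cite: LangeRump2018, §6] -/
theorem exact_eq_leaves_sum : ∀ t : SumTree, t.exact = t.leaves.sum
  | .leaf x => by simp [exact, leaves]
  | .node l r => by rw [exact, exact_eq_leaves_sum l, exact_eq_leaves_sum r]; simp [leaves]

/-- Under Proposition 1's restriction an evaluated block is at most `(1 + θ_{n-1})·Σ|x|` in
modulus. [cite: LangeRump2018, Prop 1] -/
theorem abs_eval_le_of (hp : 1 ≤ p) (hfl : IsRoundNearest p emin fl) (t : SumTree)
    (ht : ∀ x ∈ t.leaves, IsFloat p emin x)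
    (hk : 2 * ((t.leaves.length : ℚ) - 1) * unitRoundoff p ≤ 1) :
    |t.eval fl| ≤ (1 + ((t.leaves.length : ℚ) - 1) * unitRoundoff p
      / (1 + ((t.leaves.length : ℚ) - 1) * unitRoundoff p)) * absSum t := by
  have h1 := proposition1 hp hfl t ht hk
  have h2 := abs_exact_le_absSum t
  have : t.eval fl = (t.eval fl - t.exact) + t.exact := by ring
  rw [this]
  refine le_trans (abs_add_le _ _) ?_
  unfold absSum at h2 ⊢
  linarith

/-- Blockwise bounds summed over the list of blocks (inner errors and block magnitudes).
[cite: LangeRump2018, Prop 14 (proof)] -/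
theorem blocks_bounds (hp : 1 ≤ p) (hfl : IsRoundNearest p emin fl) (K : ℕ)
    (hKu : 2 * ((K : ℚ) - 1) * unitRoundoff p ≤ 1) :
    ∀ ts : List SumTree, (∀ t ∈ ts, ∀ x ∈ t.leaves, IsFloat p emin x) →
      (∀ t ∈ ts, t.leaves.length ≤ K) →
      |(ts.map (eval fl)).sum - (ts.map exact).sum|
          ≤ ((K : ℚ) - 1) * unitRoundoff p / (1 + ((K : ℚ) - 1) * unitRoundoff p)
            * (ts.map absSum).sum ∧
      ((ts.map (eval fl)).map abs).sum
          ≤ (1 + ((K : ℚ) - 1) * unitRoundoff p / (1 + ((K : ℚ) - 1) * unitRoundoff p))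
            * (ts.map absSum).sum ∧
      0 ≤ (ts.map absSum).sum
  | [], _, _ => by simp
  | t :: ts, hF, hK => by
      obtain ⟨ih1, ih2, ih3⟩ := blocks_bounds hp hfl K hKu ts (fun s hs => hF s (by simp [hs]))
        (fun s hs => hK s (by simp [hs]))
      have htF := hF t (by simp)
      have htK := hK t (by simp)
      have hu : 0 < unitRoundoff p := by unfold unitRoundoff; positivity
      have hn1 : (1 : ℚ) ≤ t.leaves.length := by exact_mod_cast one_le_length_leaves t
      have hnK : (t.leaves.length : ℚ) ≤ K := by exact_mod_cast htK
      have hkt : 2 * ((t.leaves.length : ℚ) - 1) * unitRoundoff p ≤ 1 := by nlinarith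
      have hmono := const_mono (u := unitRoundoff p) (by linarith : (0:ℚ) ≤ t.leaves.length - 1)
        (by linarith : (t.leaves.length : ℚ) - 1 ≤ K - 1) hu.le
      have hA := absSum_nonneg t
      have e1 := proposition1 hp hfl t htF hkt
      have e2 := abs_eval_le_of hp hfl t htF hkt
      unfold absSum at hA e2
      simp only [List.map_cons, List.sum_cons]
      refine ⟨?_, ?_, add_nonneg (absSum_nonneg t) ih3⟩
      · have split : (eval fl t + (ts.map (eval fl)).sum) - (exact t + (ts.map exact).sum)
            = (eval fl t - exact t) + ((ts.map (eval fl)).sum - (ts.map exact).sum) := by ring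
        rw [split]
        refine le_trans (abs_add_le _ _) ?_
        have e1' : |eval fl t - exact t| ≤ ((K : ℚ) - 1) * unitRoundoff p
            / (1 + ((K : ℚ) - 1) * unitRoundoff p) * absSum t := by
          unfold absSum
          exact le_trans e1 (mul_le_mul_of_nonneg_right hmono hA)
        linarith
      · have e2' : |eval fl t| ≤ (1 + ((K : ℚ) - 1) * unitRoundoff p
            / (1 + ((K : ℚ) - 1) * unitRoundoff p)) * absSum t := by
          unfold absSum
          exact le_trans e2 (mul_le_mul_of_nonneg_right (by linarith) hA)
        linarith

/-- TWO-LEVEL BOUND with the constants of Proposition 1: inner trees `ts` (leaves in `F`, at most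
`K` leaves each, `2(K-1)u ≤ 1`), outer tree `T` over their computed values (`B = |ts|` leaves,
`2(B-1)u ≤ 1`), all in one round-to-nearest arithmetic:
`|ŝ - Σ x| ≤ [θ_{K-1} + θ_{B-1}(1 + θ_{K-1})]·Σ|x|`. [cite: LangeRump2018, Prop 14] -/
theorem abs_twoLevel_sub_exact_le (hp : 1 ≤ p) (hfl : IsRoundNearest p emin fl)
    (ts : List SumTree) (T : SumTree) (K : ℕ) (hT : T.leaves = ts.map (eval fl))
    (hinner : ∀ t ∈ ts, ∀ x ∈ t.leaves, IsFloat p emin x) (hK : ∀ t ∈ ts, t.leaves.length ≤ K)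
    (hKu : 2 * ((K : ℚ) - 1) * unitRoundoff p ≤ 1)
    (hBu : 2 * ((ts.length : ℚ) - 1) * unitRoundoff p ≤ 1) :
    |T.eval fl - (ts.map exact).sum|
      ≤ (((K : ℚ) - 1) * unitRoundoff p / (1 + ((K : ℚ) - 1) * unitRoundoff p)
          + ((ts.length : ℚ) - 1) * unitRoundoff p / (1 + ((ts.length : ℚ) - 1) * unitRoundoff p)
            * (1 + ((K : ℚ) - 1) * unitRoundoff p / (1 + ((K : ℚ) - 1) * unitRoundoff p)))
        * (ts.map absSum).sum := by
  have hu : 0 < unitRoundoff p := by unfold unitRoundoff; positivity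
  set θa := ((K : ℚ) - 1) * unitRoundoff p / (1 + ((K : ℚ) - 1) * unitRoundoff p) with hθa
  set θb := ((ts.length : ℚ) - 1) * unitRoundoff p / (1 + ((ts.length : ℚ) - 1) * unitRoundoff p)
    with hθb
  set L := (ts.map absSum).sum with hL
  obtain ⟨hin, hleaf, hL0⟩ := blocks_bounds hp hfl K hKu ts hinner hK
  -- outer leaves are floats (computed values)
  have hTF : ∀ x ∈ T.leaves, IsFloat p emin x := by
    intro x hx
    rw [hT] at hx
    obtain ⟨t, htmem, rfl⟩ := List.mem_map.mp hx
    exact isFloat_eval hfl t (hinner t htmem)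
  have hBlen : (T.leaves.length : ℚ) = ts.length := by rw [hT, List.length_map]
  have hout := proposition1 hp hfl T hTF (by rw [hBlen]; exact hBu)
  rw [hBlen] at hout
  have habsT : (T.leaves.map abs).sum = ((ts.map (eval fl)).map abs).sum := by rw [hT]
  rw [habsT] at hout
  have hexT : T.exact = (ts.map (eval fl)).sum := by rw [exact_eq_leaves_sum, hT]
  have hB1 : (0 : ℚ) ≤ (ts.length : ℚ) - 1 ∨ ts = [] := by
    cases ts with
    | nil => exact Or.inr rfl
    | cons a l => left; simp
  rcases hB1 with hB1 | hnil
  · have hθb0 : 0 ≤ θb := by rw [hθb]; exact div_nonneg (by nlinarith) (by nlinarith)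
    have hout' : |T.eval fl - T.exact| ≤ θb * ((1 + θa) * L) :=
      le_trans hout (mul_le_mul_of_nonneg_left hleaf hθb0)
    calc |T.eval fl - (ts.map exact).sum|
        = |(T.eval fl - T.exact) + ((ts.map (eval fl)).sum - (ts.map exact).sum)| := by
          rw [hexT]; ring_nf
      _ ≤ |T.eval fl - T.exact| + |(ts.map (eval fl)).sum - (ts.map exact).sum| := abs_add_le _ _
      _ ≤ θb * ((1 + θa) * L) + θa * L := add_le_add hout' hin
      _ = (θa + θb * (1 + θa)) * L := by ring
  · subst hnil
    exfalso
    have h1 := one_le_length_leaves T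
    rw [hT] at h1
    simp at h1

/-- PROPOSITION 14 [LangeRump2018] (radix 2; generalised to arbitrary inner and outer evaluation
trees): blocks of at most `K` floats, `B` blocks, `max(K, B) - 1 ≤ ½u⁻¹`, nearest rounding ⟹
`|s - Σ xᵢⱼ| ≤ ((K - 1) + (B - 1))·u·Σ|xᵢⱼ|` (the paper's `(n + m - 2)u`).
[cite: LangeRump2018, Prop 14] -/
theorem proposition14 (hp : 1 ≤ p) (hfl : IsRoundNearest p emin fl)
    (ts : List SumTree) (T : SumTree) (K : ℕ) (hT : T.leaves = ts.map (eval fl))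
    (hinner : ∀ t ∈ ts, ∀ x ∈ t.leaves, IsFloat p emin x) (hK : ∀ t ∈ ts, t.leaves.length ≤ K)
    (hKu : 2 * ((K : ℚ) - 1) * unitRoundoff p ≤ 1)
    (hBu : 2 * ((ts.length : ℚ) - 1) * unitRoundoff p ≤ 1) (hK1 : 1 ≤ K) (hB1 : 1 ≤ ts.length) :
    |T.eval fl - (ts.map exact).sum|
      ≤ (((K : ℚ) - 1) + ((ts.length : ℚ) - 1)) * unitRoundoff p * (ts.map absSum).sum := by
  have hu : 0 < unitRoundoff p := by unfold unitRoundoff; positivity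
  have h := abs_twoLevel_sub_exact_le hp hfl ts T K hT hinner hK hKu hBu
  obtain ⟨_, _, hL0⟩ := blocks_bounds hp hfl K hKu ts hinner hK
  refine le_trans h (mul_le_mul_of_nonneg_right ?_ hL0)
  have hK1' : (1 : ℚ) ≤ K := by exact_mod_cast hK1
  have hB1' : (1 : ℚ) ≤ ts.length := by exact_mod_cast hB1
  have := blocked_const_le (a := ((ts.length : ℚ) - 1) * unitRoundoff p)
    (b := ((K : ℚ) - 1) * unitRoundoff p) (by nlinarith) (by nlinarith)
  linarith

end Literature.ComputerArithmetic.LangeRump2018
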